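import Literature.AnabelianGeometry.EtaleTheta.Discharge.Sec3Example39Base
import Literature.AnabelianGeometry.EtaleTheta.Discharge.Sec3Rmk372GenuineBase

/-!
# [EtTh] Example 3.9 (iv) «… over the slim base category `D_α` of FSM-type» AT THE GENUINE BASE `D_W := B^temp(W^log)⁰`: the two base-category clauses are THEOREMS

S. Mochizuki, *The étale theta function and its Frobenioid-theoretic manifestations*, Publ. RIMS **45** (2009), Ex. 3.9 (iv) p. 85
("`C_W^Θ` … is a tempered Frobenioid of rationally standard type over the slim base category `D_α` of FSM-type") and Rmk. 3.7.2 p. 80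
("`D₀` is slim … and of FSM-, hence also of FSMFF-, type") [cite: MochizukiEtTh2009, Ex 3.9 p.85; Rmk 3.7.2 p.80].

abc-iut cell, D-0079 ORIGINAL-L / L-F [EtTh] (FACT row F-0616 `Example39Data.Example39_iv_facts`; cone node `EtTh:Ex3.9(iv)`), seat
abc-iut-w6-d053 (gen 5), companion of the census `LF-ETTH-S5A.tsv` (row F-0616: «CONDITIONAL ⟸ {hrat, hslim, hfsm}; hfsm a THEOREM at
`B^temp(Π)⁰`»).  PROOF-ONLY (0 definitions, no instance, no new `Prop`): for Example-3.9 data `E` whose `D_W` IS the genuine connected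
temperoid `ConnectedPart (BTemp W.Pi)` of a [SemiAnbd] Ex. 3.10 datum `W : TemperedArithmeticGroup K` (tempered + temp-slim `Π^tp_W`),
abc-iut-L2-d2's reduction `Example39Data.example39_iv_facts_of (h) (hrat) (hslim) (hfsm)` (`Discharge/Sec3Example39Base.lean`) has its two
base-category inputs DISCHARGED BY NAME from abc-iut lineage's `TemperedArithmeticGroup.remark372_holds W : Remark372 (ConnectedPart (BTemp W.Pi))`
(= `IsSlim ∧ IsOfFSMType ∧ IsOfFSMFFType`, `Discharge/Sec3Rmk372GenuineBase.lean`) — leaving EXACTLY ONE input, the rationality clause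
`hrat : (E.thetaFrobenioid α h).IsRational` («of rationally standard type», [FrdI] Def. 4.5), next to the vocabulary record `h : E.FrobenioidHyp α VD`.
Nothing landed is edited or restated.
HONEST FRAMING: kernel re-keying (no new mathematics); `Example39Data` over the genuine base is a PARAMETER record (not shown inhabited here);
refereed pre-IUT material; nothing here bears on [IUTchIII] Cor. 3.12; no side taken; typed ≠ proved.
-/

noncomputable section

namespace Literature.AnabelianGeometry.EtaleTheta

open CategoryTheory Opposite Literature.AlgebraicGeometry.Frobenioids Literature.AnabelianGeometry.SemiGraphs

namespace Example39Data

universe u₀ w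

variable {K : Type u₀} [Field K] (W : TemperedArithmeticGroup.{u₀} K) {V : FrdIMonoidStub.{w}}
  {TW : RealifiedDivisorMonoids (D₀ := ConnectedPart (BTemp W.Pi)) V}
  (E : Example39Data V (ConnectedPart (BTemp W.Pi)) TW) {A B : ConnectedPart (BTemp W.Pi)} (α : A ⟶ B)

/-- **F-0616 [EtTh] Ex. 3.9 (iv) at the GENUINE base `D_W := B^temp(W^log)⁰`**, modulo ONLY the rationality clause `hrat` (and the vocabulary
record `h`): the clauses «the slim base category `D_α`» and «of FSM-type» are supplied by Rmk. 3.7.2 at the genuine connected temperoid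
(`TemperedArithmeticGroup.remark372_holds`: `B^temp(W^log)⁰` is slim and of FSM-type for `Π^tp_W` tempered and temp-slim) through
abc-iut-L2-d2's `example39_iv_facts_of`. [cite: MochizukiEtTh2009, Ex 3.9 p.85] -/
theorem example39_iv_facts_bTemp {VD : FrdICatStub.{max (u₀ + 1) u₀, u₀, w} (Dα α)} (h : E.FrobenioidHyp α VD)
    (hrat : (E.thetaFrobenioid α h).IsRational) : E.Example39_iv_facts α h :=
  E.example39_iv_facts_of α h hrat (TemperedArithmeticGroup.remark372_holds W).1 (TemperedArithmeticGroup.remark372_holds W).2.1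

/-- The two base-category conjuncts of `Example39_iv_facts` at the genuine base, with NO hypothesis on `E` beyond the vocabulary record:
`D_α` is slim and of FSM-type. [cite: MochizukiEtTh2009, Ex 3.9 p.85; Rmk 3.7.2 p.80] -/
theorem isSlim_and_isOfFSMType_Dα_bTemp : IsSlim (Dα α) ∧ IsOfFSMType (Dα α) :=
  ⟨isSlim_Dα α (TemperedArithmeticGroup.remark372_holds W).1, isOfFSMType_Dα α (TemperedArithmeticGroup.remark372_holds W).2.1⟩

end Example39Data

end Literature.AnabelianGeometry.EtaleTheta

end
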